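import Summits.ResolutionOfSingularities.ResolutionOfSingularities.Theorems.PurelyInseparableDim4E2OfCJSAllPrimes
import Summits.ResolutionOfSingularities.ResolutionOfSingularities.Theorems.PurelyInseparableDim4ResConeMidTameSlices
import HarnessLib

/-!
# F4-I for every prime ⟸ CJS Thm 6.40 ∧ the two MID-SHADE TAME SLICES over algebraically closed fields —
# the cell's F4-I question reduced BY NAME to its located residue (assembly only; cell `res-dim4-pi`)

[OURS · counted 0 · AI work weaker than expert review.]  Cell `res-dim4-pi` (D-0157 DOOR 2), seat res-dim4-p-2 g3
(holder of the E2 / p-program / F4-I row table).  NOTHING here proves K2(p) (`RidgeBudget.NoAboveFloorTrap p p`,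
OPEN for `p ≥ 5`), the Cossart–Jannsen–Saito theorem (`KeyTheorem640_char_localized_isolated`, F-111, a cited
unproved Literature fact and the only published input), or resolution of singularities in dimension ≥ 4 /
characteristic `p`.

Composition of two landed sentences:
* res-dim4-p-3 g2's `E2OfCJS.noIsolatedTrapQuestion_iff_of_KeyTheorem640` (p672449, over res-dim4-p-2 g2's p-program
  p671312 and res-dim4-p-12 g2's trichotomy): given F-111, `NoIsolatedTrapQuestion ⟺ ∀ primes p ≥ 5, K2(p)`;
* `K2BaseChange.noAboveFloorTrap_iff_midTameSlices_algClosed` (p675531: tameSlices p673897 ∘ algClosed p674766 ∘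
  slice A p673465 ∘ phase `d = 1` p674478): `K2(p) ⟺` no located constant-`(d, e_G)` isolated above-floor `Step0 p`
  chain with `x^{r₀} ∣ F₀`, `2 ≤ d < p`, `e_G ∈ {3, 2}`, over any ALGEBRAICALLY CLOSED field of characteristic `p`.

* **`noIsolatedTrap_of_KeyTheorem640_of_no_midTameSlices`** — for ONE prime `p`: F4-I(p,p) ⟸ F-111 ∧ ¬B′(K̄) ∧ ¬C′(K̄);
* **`noIsolatedTrapQuestion_of_KeyTheorem640_of_no_midTameSlices`** / **`noIsolatedTrapQuestion_iff_midTameSlices_of_KeyTheorem640`**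
  — THE SENTENCE: given F-111, the cell's question F4-I is EQUIVALENT to «for every prime `p ≥ 5` and every
  algebraically closed field `L` of characteristic `p`: no slice-B′ chain and no slice-C′ chain over `L`».

bears_on: LADDER-RESOLUTION:D157-DOOR2 (res-dim4-pi · F4-I row · located residue).  Supports
stmt-ResolutionOfSingularities-16155 (helper).
-/

set_option linter.dupNamespace false -- mandated namespace of this single-conjunct summit

noncomputable section

namespace Summit.ResolutionOfSingularities.ResolutionOfSingularities.Theorems.PIDim4

namespace E2OfCJS

open Literature.AlgebraicGeometry.CossartJannsenSaito2020
open Literature.AlgebraicGeometry.Resolution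
open Literature.AlgebraicGeometry.Resolution.Hauser2010
open RidgeBudget (NoAboveFloorTrap)
open ResCone (resVertex)

/-- **F4-I(p,p) ⟸ F-111 ∧ ¬B′(K̄) ∧ ¬C′(K̄)** (`p` prime): no infinite isolated chain of point blow-ups of
`z^p + F(x₀,…,x₃)` in characteristic `p`, GIVEN the named fact `KeyTheorem640_char_localized_isolated` and the
emptiness, over every algebraically closed field of characteristic `p`, of the two located slices (constant shade
`2 ≤ d < p`, `x^{r₀} ∣ F₀`, constant `e_G = 3` resp. `= 2`). [OURS · conditional assembly]
[cite: CossartJannsenSaito2020, Thm. 6.40] -/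
theorem noIsolatedTrap_of_KeyTheorem640_of_no_midTameSlices (p : ℕ) [Fact p.Prime]
    (hK640 : KeyTheorem640_char_localized_isolated.{0})
    (hB : ∀ (L : Type) [Field L] [IsAlgClosed L] [CharP L p] [DecidableEq L],
      ¬ ∃ (c : ℕ → State L) (d : ℕ), 2 ≤ d ∧ d < p ∧
          (∀ e' ∈ (c 0).F.support, (c 0).r ≤ e') ∧
          ∀ k, IsIsolated p (c k).F ∧ Step0 p (c k) (c (k + 1)) ∧ ordZero (c k).F ≠ p ∧
            (c k).shade = (d : ℕ∞) ∧ Module.finrank L (resVertex (c k)) = 3)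
    (hC : ∀ (L : Type) [Field L] [IsAlgClosed L] [CharP L p] [DecidableEq L],
      ¬ ∃ (c : ℕ → State L) (d : ℕ), 2 ≤ d ∧ d < p ∧
          (∀ e' ∈ (c 0).F.support, (c 0).r ≤ e') ∧
          ∀ k, IsIsolated p (c k).F ∧ Step0 p (c k) (c (k + 1)) ∧ ordZero (c k).F ≠ p ∧
            (c k).shade = (d : ℕ∞) ∧ Module.finrank L (resVertex (c k)) = 2) :
    NoIsolatedTrap p p :=
  noIsolatedTrap_prime_of_KeyTheorem640_of_noAboveFloorTrap p hK640
    (K2BaseChange.noAboveFloorTrap_of_no_midTameSlices_algClosed p hB hC)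

/-- **F4-I for every prime ⟸ F-111 ∧ the two mid-shade tame slices over `K̄` for the primes `p ≥ 5`.**
[OURS · conditional assembly] [cite: CossartJannsenSaito2020, Thm. 6.40] -/
theorem noIsolatedTrapQuestion_of_KeyTheorem640_of_no_midTameSlices
    (hK640 : KeyTheorem640_char_localized_isolated.{0})
    (h : ∀ p : ℕ, p.Prime → 5 ≤ p →
      ∀ (L : Type) [Field L] [IsAlgClosed L] [CharP L p] [DecidableEq L],
        (¬ ∃ (c : ℕ → State L) (d : ℕ), 2 ≤ d ∧ d < p ∧
            (∀ e' ∈ (c 0).F.support, (c 0).r ≤ e') ∧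
            ∀ k, IsIsolated p (c k).F ∧ Step0 p (c k) (c (k + 1)) ∧ ordZero (c k).F ≠ p ∧
              (c k).shade = (d : ℕ∞) ∧ Module.finrank L (resVertex (c k)) = 3) ∧
        (¬ ∃ (c : ℕ → State L) (d : ℕ), 2 ≤ d ∧ d < p ∧
            (∀ e' ∈ (c 0).F.support, (c 0).r ≤ e') ∧
            ∀ k, IsIsolated p (c k).F ∧ Step0 p (c k) (c (k + 1)) ∧ ordZero (c k).F ≠ p ∧
              (c k).shade = (d : ℕ∞) ∧ Module.finrank L (resVertex (c k)) = 2)) :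
    NoIsolatedTrapQuestion :=
  noIsolatedTrapQuestion_of_KeyTheorem640_of_K2 hK640 fun p hp h5 =>
    haveI : Fact p.Prime := ⟨hp⟩
    (K2BaseChange.noAboveFloorTrap_iff_midTameSlices_algClosed p).mpr (h p hp h5)

/-- **THE SENTENCE, located form.**  Given CJS Thm 6.40 (F-111), the cell's question F4-I (`NoIsolatedTrapQuestion`)
is EQUIVALENT to: for every prime `p ≥ 5` and every algebraically closed field `L` of characteristic `p` there is no
isolated above-floor `Step0 p` chain with `x^{r₀} ∣ F₀`, constant shade `2 ≤ d < p` and constant `e_G = 3`, nor one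
with `e_G = 2`.  (At `p = 5`: `d ∈ {2, 3, 4}`.)  These binders LOCATE what is open; nothing about them is proved here.
[OURS · conditional on the NAMED PUBLISHED FACT only] [cite: CossartJannsenSaito2020, Thm. 6.40] -/
theorem noIsolatedTrapQuestion_iff_midTameSlices_of_KeyTheorem640
    (hK640 : KeyTheorem640_char_localized_isolated.{0}) :
    NoIsolatedTrapQuestion ↔ ∀ p : ℕ, p.Prime → 5 ≤ p →
      ∀ (L : Type) [Field L] [IsAlgClosed L] [CharP L p] [DecidableEq L],
        (¬ ∃ (c : ℕ → State L) (d : ℕ), 2 ≤ d ∧ d < p ∧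
            (∀ e' ∈ (c 0).F.support, (c 0).r ≤ e') ∧
            ∀ k, IsIsolated p (c k).F ∧ Step0 p (c k) (c (k + 1)) ∧ ordZero (c k).F ≠ p ∧
              (c k).shade = (d : ℕ∞) ∧ Module.finrank L (resVertex (c k)) = 3) ∧
        (¬ ∃ (c : ℕ → State L) (d : ℕ), 2 ≤ d ∧ d < p ∧
            (∀ e' ∈ (c 0).F.support, (c 0).r ≤ e') ∧
            ∀ k, IsIsolated p (c k).F ∧ Step0 p (c k) (c (k + 1)) ∧ ordZero (c k).F ≠ p ∧
              (c k).shade = (d : ℕ∞) ∧ Module.finrank L (resVertex (c k)) = 2) := by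
  refine ⟨fun hQ p hp h5 L _ _ _ _ => ?_, noIsolatedTrapQuestion_of_KeyTheorem640_of_no_midTameSlices hK640⟩
  haveI : Fact p.Prime := ⟨hp⟩
  exact (K2BaseChange.noAboveFloorTrap_iff_midTameSlices_algClosed p).mp
    ((noIsolatedTrapQuestion_iff_of_KeyTheorem640 hK640).mp hQ p hp h5) L

end E2OfCJS

end Summit.ResolutionOfSingularities.ResolutionOfSingularities.Theorems.PIDim4

end
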